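/-
Copyright (c) 2026. Released under Apache 2.0 license.
-/
import Literature.NumberTheory.ModularForms.ModularGroupCommutatorCongruence
import Mathlib.GroupTheory.Transfer
import HarnessLib

/-!
# `SL₂(ℤ)`-invariant homomorphisms on `Γ(N)` (around CDT Corollary 4.5.3)

The input `hcor` of the tree's assembled Unbounded Denominators theorem
(`CalegariDimitrovTang2025_unboundedDenominators.of_two_inputs`) was reduced in
`UnboundedDenominatorsCor453Reduction` to its **invariant form**: an `SL₂(ℤ)`-conjugation-invariant
homomorphism `θ : Γ(N) → Q` to a finite abelian group is trivial on some `Γ(M)`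
([CalegariDimitrovTang2025, Cor. 4.5.3], which CDT deduce from their cohomological Thm. 4.5.2).  This file
records the elementary group theory around that statement:

* `map_eq_one_of_mem_commutator` — an invariant `θ` kills the commutator subgroup `[SL₂(ℤ), Γ(N)]`; hence
  (`cor453_invariant_form_of_commutator_congruence`) the invariant form FOLLOWS from the classical statement
  «for every `N ≥ 1` the commutator `[SL₂(ℤ), Γ(N)]` contains some `Γ(M)`» (Beyl's computation of the Schur
  multiplier of `SL₂(ℤ/N)`, [Beyl1986]; expected `M = lcm(N, 12)` for `4 ∤ N` and `M = lcm(2N, 24)` for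
  `4 ∣ N`).  The converse (the two statements are equivalent) is in a sequel file.
* `transfer_eq_pow_of_forall_conj` — the transfer `G → A` of a conjugation-invariant `ϕ : H → A` (`H ⊴ G` of
  finite index) is `h ↦ ϕ(h)^{[G:H]}` on `H`; consequently (`pow_index_eq_one_of_invariant`, using
  `SL₂(ℤ)ᵃᵇ ≅ ℤ/12`) **every invariant `θ : Γ(N) → Q` satisfies `θ(x)^{12·[SL₂(ℤ):Γ(N)]} = 1`**, and an
  invariant `θ` into a finite abelian group of order prime to `12·[SL₂(ℤ):Γ(N)]` is trivial
  (`eq_one_of_invariant_of_coprime`) — the invariant form of Cor. 4.5.3 in the coprime case, with `M = 1`.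
* `pow_index_mem_commutator_of_mem_center` — the transfer lemma behind the Sylow-by-Sylow analysis of the
  general case: a central element of `[G, G]` has its `[G:H]`-th power in `[H, H]`.

Not here: the general case of the invariant form (central extensions of `SL₂(ℤ/N)`; [Beyl1986],
[CalegariDimitrovTang2025, Thm. 4.5.2]).
-/

open scoped MatrixGroups commutatorElement

namespace Literature.NumberTheory.Automorphic

namespace UnboundedDenominators

open CongruenceSubgroup Matrix.SpecialLinearGroup ModularGroup

/-! ### Invariance kills the commutator `[SL₂(ℤ), Γ(N)]` -/

/-- An `SL₂(ℤ)`-conjugation-invariant homomorphism `θ : Γ(N) → Q` to a commutative group is trivial on the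
commutator subgroup `[SL₂(ℤ), Γ(N)]` (`θ(gxg⁻¹x⁻¹) = θ(gxg⁻¹)θ(x)⁻¹ = 1`).
[cite: CalegariDimitrovTang2025, Corollary 4.5.3] -/
theorem map_eq_one_of_mem_commutator {N : ℕ} {Q : Type*} [CommGroup Q] (θ : Gamma N →* Q)
    (hθ : ∀ (g x : SL(2, ℤ)) (hx : x ∈ Gamma N) (hgx : g * x * g⁻¹ ∈ Gamma N),
      θ ⟨g * x * g⁻¹, hgx⟩ = θ ⟨x, hx⟩)
    {x : SL(2, ℤ)} (hxc : x ∈ ⁅(⊤ : Subgroup SL(2, ℤ)), Gamma N⁆) (hx : x ∈ Gamma N) :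
    θ ⟨x, hx⟩ = 1 := by
  have key : ∀ y ∈ ⁅(⊤ : Subgroup SL(2, ℤ)), Gamma N⁆, ∃ hy : y ∈ Gamma N, θ ⟨y, hy⟩ = 1 := by
    intro y hy
    rw [Subgroup.commutator_def] at hy
    refine Subgroup.closure_induction (p := fun (y : SL(2, ℤ)) _ ↦
        ∃ hy : y ∈ Gamma N, θ ⟨y, hy⟩ = 1) ?_ ?_ ?_ ?_ hy
    · rintro _ ⟨g, -, b, hb, rfl⟩
      have hgb : g * b * g⁻¹ ∈ Gamma N := (Gamma_normal N).conj_mem b hb g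
      have hmem : g * b * g⁻¹ * b⁻¹ ∈ Gamma N := mul_mem hgb (inv_mem hb)
      refine ⟨by rwa [commutatorElement_def], ?_⟩
      have heq : ∀ h, (⟨⁅g, b⁆, h⟩ : Gamma N) = ⟨g * b * g⁻¹, hgb⟩ * ⟨b, hb⟩⁻¹ :=
        fun h ↦ Subtype.ext (by simp [commutatorElement_def])
      rw [heq, map_mul, map_inv, hθ g b hb hgb, mul_inv_cancel]
    · exact ⟨one_mem _, map_one θ⟩
    · rintro a b _ _ ⟨ha, ha1⟩ ⟨hb, hb1⟩
      refine ⟨mul_mem ha hb, ?_⟩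
      have heq : (⟨a * b, mul_mem ha hb⟩ : Gamma N) = ⟨a, ha⟩ * ⟨b, hb⟩ := rfl
      rw [heq, map_mul, ha1, hb1, one_mul]
    · rintro a _ ⟨ha, ha1⟩
      refine ⟨inv_mem ha, ?_⟩
      have heq : (⟨a⁻¹, inv_mem ha⟩ : Gamma N) = ⟨a, ha⟩⁻¹ := rfl
      rw [heq, map_inv, ha1, inv_one]
  obtain ⟨_, h⟩ := key x hxc
  exact h

/-- **The invariant form of CDT Cor. 4.5.3 follows from «`[SL₂(ℤ), Γ(N)]` is a congruence subgroup for every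
`N ≥ 1`»** (no finiteness of the target is needed in this direction).
[cite: CalegariDimitrovTang2025, Corollary 4.5.3] -/
theorem cor453_invariant_form_of_commutator_congruence
    (hK : ∀ N : ℕ, N ≠ 0 → ∃ M : ℕ, M ≠ 0 ∧ Gamma M ≤ ⁅(⊤ : Subgroup SL(2, ℤ)), Gamma N⁆)
    (N : ℕ) (Q : Type*) [CommGroup Q] (θ : Gamma N →* Q)
    (hθ : ∀ (g x : SL(2, ℤ)) (hx : x ∈ Gamma N) (hgx : g * x * g⁻¹ ∈ Gamma N),
      θ ⟨g * x * g⁻¹, hgx⟩ = θ ⟨x, hx⟩) :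
    ∃ M : ℕ, M ≠ 0 ∧ ∀ (x : SL(2, ℤ)) (hx : x ∈ Gamma N), x ∈ Gamma M → θ ⟨x, hx⟩ = 1 := by
  rcases Nat.eq_zero_or_pos N with rfl | hN
  · refine ⟨1, one_ne_zero, fun x hx _ ↦ ?_⟩
    have hx1 : x = 1 := by simpa [Gamma_zero_bot] using hx
    have : (⟨x, hx⟩ : Gamma 0) = 1 := Subtype.ext hx1
    rw [this, map_one]
  · obtain ⟨M, hM, hle⟩ := hK N hN.ne'
    exact ⟨M, hM, fun x hx hxM ↦ map_eq_one_of_mem_commutator θ hθ (hle hxM) hx⟩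

/-! ### Transfer of a conjugation-invariant homomorphism -/

/-- **Transfer of an invariant homomorphism.** Let `H ≤ G` have finite index and let `ϕ : H → A` (`A`
commutative) be invariant under `G`-conjugation: `ϕ(ghg⁻¹) = ϕ(h)` whenever both sides make sense.  Then the
transfer `V : G → A` of `ϕ` satisfies `V(h) = ϕ(h)^{[G:H]}` for `h ∈ H` (each orbit of `⟨h⟩` on `G/H`
contributes `ϕ(g₀⁻¹ h^m g₀) = ϕ(h)^m`, and the orbit lengths sum to the index; Rotman's transfer evaluation
formula). [cite: Rotman1995, Lemma 7.46] -/
theorem transfer_eq_pow_of_forall_conj {G : Type*} [Group G] {H : Subgroup G} [H.FiniteIndex]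
    {A : Type*} [CommGroup A] (ϕ : H →* A)
    (hϕ : ∀ (g h : G) (hh : h ∈ H) (hgh : g * h * g⁻¹ ∈ H), ϕ ⟨g * h * g⁻¹, hgh⟩ = ϕ ⟨h, hh⟩)
    (h : G) (hh : h ∈ H) : MonoidHom.transfer ϕ h = ϕ ⟨h, hh⟩ ^ H.index := by
  classical
  letI := H.fintypeQuotientOfFiniteIndex
  have hϕ' : ∀ (g x : G) (hx : x ∈ H) (hgx : g⁻¹ * x * g ∈ H), ϕ ⟨g⁻¹ * x * g, hgx⟩ = ϕ ⟨x, hx⟩ := by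
    intro g x hx hgx
    have h1 : g⁻¹ * x * g⁻¹⁻¹ ∈ H := by rwa [inv_inv]
    have h2 := hϕ g⁻¹ x hx h1
    have h3 : (⟨g⁻¹ * x * g⁻¹⁻¹, h1⟩ : H) = ⟨g⁻¹ * x * g, hgx⟩ :=
      Subtype.ext (show g⁻¹ * x * g⁻¹⁻¹ = g⁻¹ * x * g by rw [inv_inv])
    rw [h3] at h2
    exact h2
  rw [MonoidHom.transfer_eq_prod_quotient_orbitRel_zpowers_quot,
    Subgroup.index_eq_sum_minimalPeriod H h, ← Finset.prod_pow_eq_pow_sum]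
  refine Finset.prod_congr rfl fun q _ ↦ ?_
  rw [hϕ' _ _ (H.pow_mem hh _), ← map_pow]
  rfl

/-- **Exponent bound.** An `SL₂(ℤ)`-invariant homomorphism `θ : Γ(N) → Q` (`N ≥ 1`, `Q` a commutative group)
satisfies `θ(x)^{12·[SL₂(ℤ):Γ(N)]} = 1` for every `x ∈ Γ(N)`: the transfer of `θ` is a homomorphism
`SL₂(ℤ) → Q`, hence of order dividing `12` (`SL₂(ℤ)ᵃᵇ ≅ ℤ/12`), and restricts to `θ^{[SL₂(ℤ):Γ(N)]}` on
`Γ(N)`.  (In particular `Γ(N)/[SL₂(ℤ), Γ(N)]` has exponent dividing `12·[SL₂(ℤ):Γ(N)]`.)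
[cite: CalegariDimitrovTang2025, Corollary 4.5.3] -/
theorem pow_index_eq_one_of_invariant {N : ℕ} [NeZero N] {Q : Type*} [CommGroup Q]
    (θ : Gamma N →* Q)
    (hθ : ∀ (g x : SL(2, ℤ)) (hx : x ∈ Gamma N) (hgx : g * x * g⁻¹ ∈ Gamma N),
      θ ⟨g * x * g⁻¹, hgx⟩ = θ ⟨x, hx⟩)
    (x : Gamma N) : θ x ^ (12 * (Gamma N).index) = 1 := by
  have h1 : MonoidHom.transfer θ (x : SL(2, ℤ)) = θ x ^ (Gamma N).index := by
    rw [transfer_eq_pow_of_forall_conj θ hθ x x.2]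
  have h2 := Literature.NumberTheory.ModularForms.SL2Z.map_pow_twelve (MonoidHom.transfer θ) (x : SL(2, ℤ))
  rw [h1, ← pow_mul, mul_comm] at h2
  exact h2

/-- **The coprime case of the invariant form of CDT Cor. 4.5.3**: an `SL₂(ℤ)`-invariant homomorphism from
`Γ(N)` (`N ≥ 1`) to a finite commutative group whose order is prime to `12·[SL₂(ℤ):Γ(N)]` is trivial.
[cite: CalegariDimitrovTang2025, Corollary 4.5.3] -/
theorem eq_one_of_invariant_of_coprime {N : ℕ} [NeZero N] {Q : Type*} [CommGroup Q] [Finite Q]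
    (θ : Gamma N →* Q)
    (hθ : ∀ (g x : SL(2, ℤ)) (hx : x ∈ Gamma N) (hgx : g * x * g⁻¹ ∈ Gamma N),
      θ ⟨g * x * g⁻¹, hgx⟩ = θ ⟨x, hx⟩)
    (hcop : (Nat.card Q).Coprime (12 * (Gamma N).index)) (x : Gamma N) : θ x = 1 := by
  have h1 := pow_index_eq_one_of_invariant θ hθ x
  have h2 : θ x ^ Nat.card Q = 1 := pow_card_eq_one'
  have h3 : orderOf (θ x) ∣ Nat.gcd (Nat.card Q) (12 * (Gamma N).index) :=
    Nat.dvd_gcd (orderOf_dvd_of_pow_eq_one h2) (orderOf_dvd_of_pow_eq_one h1)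
  rw [Nat.Coprime.gcd_eq_one hcop, Nat.dvd_one] at h3
  exact orderOf_eq_one_iff.mp h3

/-- The coprime case in the exact shape of the invariant form (`UnboundedDenominatorsCor453Reduction`,
hypothesis `hinv` of `cor453_of_invariant_form`), with `M = 1`. [cite: CalegariDimitrovTang2025, Corollary 4.5.3] -/
theorem cor453_invariant_form_of_coprime (N : ℕ) (hN : N ≠ 0) (Q : Type*) [CommGroup Q] [Finite Q]
    (θ : Gamma N →* Q)
    (hθ : ∀ (g x : SL(2, ℤ)) (hx : x ∈ Gamma N) (hgx : g * x * g⁻¹ ∈ Gamma N),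
      θ ⟨g * x * g⁻¹, hgx⟩ = θ ⟨x, hx⟩)
    (hcop : (Nat.card Q).Coprime (12 * (Gamma N).index)) :
    ∃ M : ℕ, M ≠ 0 ∧ ∀ (x : SL(2, ℤ)) (hx : x ∈ Gamma N), x ∈ Gamma M → θ ⟨x, hx⟩ = 1 := by
  haveI : NeZero N := ⟨hN⟩
  exact ⟨1, one_ne_zero, fun x hx _ ↦ eq_one_of_invariant_of_coprime θ hθ hcop ⟨x, hx⟩⟩

/-! ### The transfer lemma for central elements -/

/-- **Transfer lemma (Schur).** If `z ∈ H` is central in `G` and lies in the commutator subgroup `[G, G]`,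
and `H` has finite index, then `z^{[G:H]} ∈ [H, H]`: the transfer `G → Hᵃᵇ` kills `[G, G]` and equals
`z ↦ z^{[G:H]}` on central elements.  (With `H` the preimage of a Sylow `ℓ`-subgroup this reduces
`Z ∩ [G, G] = 1`, for a central `ℓ`-group `Z`, to the same statement inside `H`; this is the step
`V(a) = aⁿ` on `G' ∩ Z(G)` in Schur's theorem.) [cite: Rotman1995, Theorem 7.47] -/
theorem pow_index_mem_commutator_of_mem_center {G : Type*} [Group G] (H : Subgroup G) [H.FiniteIndex]
    {z : G} (hzH : z ∈ H) (hzc : z ∈ Subgroup.center G) (hz : z ∈ commutator G) :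
    (⟨z, hzH⟩ : H) ^ H.index ∈ commutator H := by
  have key : ∀ (k : ℕ) (g₀ : G), g₀⁻¹ * z ^ k * g₀ ∈ H → g₀⁻¹ * z ^ k * g₀ = z ^ k := by
    intro k g₀ _
    have hc : z ^ k ∈ Subgroup.center G := Subgroup.pow_mem _ hzc k
    rw [Subgroup.mem_center_iff] at hc
    rw [mul_assoc, ← hc g₀, ← mul_assoc, inv_mul_cancel, one_mul]
  have h := MonoidHom.transfer_eq_pow (Abelianization.of (G := H)) z key
  have h1 : MonoidHom.transfer (Abelianization.of (G := H)) z = 1 :=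
    Abelianization.commutator_subset_ker _ hz
  rw [h1] at h
  have h2 : (⟨z ^ H.index, MonoidHom.transfer_eq_pow_aux z key⟩ : H) ∈
      (Abelianization.of (G := H)).ker := h.symm
  rw [Abelianization.ker_of] at h2
  have h3 : (⟨z, hzH⟩ : H) ^ H.index = ⟨z ^ H.index, MonoidHom.transfer_eq_pow_aux z key⟩ :=
    Subtype.ext (by simp)
  rwa [h3]

end UnboundedDenominators

end Literature.NumberTheory.Automorphic
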